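import Summits.ResolutionOfSingularities.ResolutionOfSingularities.Theorems.HilbertSamuelEliminationSigmaMaxModificationsCorridor3WLadderStrataDepthMoving
import HarnessLib

/-!
# [OURS · L1 W4.2] `Corridor3WLadderStrataDepthStep` — «MOVING BIRTHS ARE CURVES» as a STEP LEMMA (one canonical near step under the
# cycle invariant; no chain, no origin, no eventual quantifier) — the form res-L1-w42-plan-1 RULINGS v3.14-8 (CA) asks the Ω strata
# family to re-use («stated over one blow-up step … no eventual/run-level quantifier»)

Crux chain w42 (`SigmaMaxModifications`, stmt-ResolutionOfSingularities-18506; conjunct `SigmaMaxModificationsCorridor3`,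
stmt-ResolutionOfSingularities-19249), object D13-DD (res-type-053 gen 10). OURS (cell res-hironaka, slot W4.2); NOT statements of
H. Hironaka's manuscript [Hironaka2017] nor of [CossartJannsenSaito2020]; AI-proved, weaker than expert review. Sorry-free PROOF file (no
definition, no named fact, no binder, no `CharHypothesis`). `--supports stmt-ResolutionOfSingularities-19249 --as helper`.

* `not_hasSandwichAt_of_isMovingBirthAt` — **STEP LEMMA**: for ONE canonical near step `s → s'` at level `3` read through its step
  projection `f`, with `s` under the cycle invariant `CycleInv k R 3 ν s` (admissible functional oracle, `ν ≠ Φ^{(3)}`), `x_n` closed,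
  and `s'` between cycles (`s'.P = none`): a MOVING-BIRTH newborn `Z' ∋ x_{n+1}` has no sandwich at `x_{n+1}` (`codim_{Z'}(x_{n+1}) ≤ 1`).
  Same proof as the chain form `shallowMovingBirths_three` (…StrataDepthMoving): host surface `S` of the birth (040's
  `IsMovingBirthAt.exists_host`) ⇒ `dim 𝒪_{V(C),x_n} ≥ 2` in `dim 𝒪_{X_n,x_n} ≤ 3` ⇒ the fibre of the permissible blow-up over `x_n`
  is zero-dimensional at `x_{n+1}` (LIB `PermissibleBlowupFibreDimension`) ⇒ `codim_{Z'}(x_{n+1}) ≤ codim_B(x_n) ≤ 1`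
  (LIB `FibreCoheightInequality`; `B = cl f(Z') ⊊ S`, `H(η_S) = ν ≠ Φ^{(3)}`). Char-free.
(The chain form is `shallowMovingBirths_three` of `…StrataDepthMoving`: apply the step lemma at `c n` with `exists_cycleInv_chain` and
`Reaches.isClosed_pt`.)
-/

noncomputable section

set_option linter.dupNamespace false

open CategoryTheory AlgebraicGeometry TopologicalSpace Topology Order IsLocalRing
open Summit.ResolutionOfSingularities.ResolutionOfSingularities.Theorems.CampaignW42
open Literature.AlgebraicGeometry.Resolution Literature.RingTheory.HilbertSamuel
open Summit.ResolutionOfSingularities.ResolutionOfSingularities.Theorems.SigmaMaxModificationsCorridor3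
open Scheme.IdealSheafData

namespace Summit.ResolutionOfSingularities.ResolutionOfSingularities.Theorems.SigmaMaxModificationsCorridor3.Moving

universe u

variable {R : ∀ S : Scheme.{u}, CentreSeq S → Prop} {ν : ℕ → ℕ}

/-- **STEP LEMMA — A MOVING BIRTH THROUGH THE CHAIN POINT IS A CURVE THERE.** For one canonical near step `s → s'` at level `3`
(admissible functional oracle, `ν ≠ Φ^{(3)}`) with `s` under the cycle invariant, `x_n = s.pt` closed and `s'.P = none`, read through its
step projection `f`: a moving-birth newborn `Z' ∋ x_{n+1}` of `X_{n+1}(ν)` has no sandwich at `x_{n+1}`. No chain, no origin, no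
eventual quantifier; every characteristic. [cite: CossartJannsenSaito2020, Thm. 3.10 (proof, p. 46)] [cite: Matsumura1987, Thm. 15.1] -/
theorem not_hasSandwichAt_of_isMovingBirthAt {k : Type u} [Field k] (hRf : OracleFunctional R) (hRa : OracleAdmissible R)
    (hν : ν ≠ iterPSum 3 Phi) {s s' : MarkedStage.{u}} (h : CycleInv k R 3 ν s) (hsc : IsClosed ({s.pt} : Set s.W))
    (hst : CanonicalNearStep R 3 ν s s') (hnone : s'.P = none) {f : s'.W ⟶ s.W} (hf : StepProjection R 3 ν s s' f)
    {Z' : Set s'.W} (hZ' : IsMovingBirthAt 3 ν s s' f Z') : ¬ HasSandwichAt s' Z' := by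
  intro hsand
  have h' : CycleInv k R 3 ν s' := h.step hRa hν hst
  haveI := s.ln
  haveI := s'.ln
  haveI : IsReduced s.W := h.isReduced
  -- the host of the birth
  obtain ⟨S, hS, -, hSC, hBS, hBneS, hsandS⟩ := hZ'.exists_host hRf hRa hν h hst hnone hf
  obtain ⟨C, P', hcs, hbl⟩ := hf.exists_isCanonicalStep_and_isBlowup
  have hSsub : S ⊆ (C.support : Set s.W) := hSC C P' hcs
  obtain ⟨-, -, hpermC, -⟩ := h.centre hRa hν hcs
  -- the points and the sets
  set x' : s'.W := s'.pt with hx'def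
  have hZ'c : Z' ∈ componentsThrough 3 ν s' := hZ'.1.1
  have hirrZ' : IsIrreducible Z' := componentsIn.isIrreducible hZ'c.1
  have hclZ' : IsClosed Z' := componentsIn.isClosed h'.isClosed_hsStratum hZ'c.1
  have hx'Z' : x' ∈ Z' := hZ'c.2
  have hfx : f.base x' = s.pt := hf.base_pt
  have hyB : f.base x' ∈ closure (f.base '' Z') := subset_closure ⟨x', hx'Z', rfl⟩
  have hirrS : IsIrreducible S := componentsIn.isIrreducible hS.1
  have hclS : IsClosed S := componentsIn.isClosed h.isClosed_hsStratum hS.1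
  have hyS : f.base x' ∈ S := by rw [hfx]; exact hS.2
  have hyC : f.base x' ∈ (C.support : Set s.W) := hSsub hyS
  -- the two sandwiches
  have h2Z' : 2 ≤ coheight (⟨x', hx'Z'⟩ : ↥Z') :=
    (two_le_coheight_iff_exists_sandwich hirrZ' hclZ' hx'Z' hf.isClosed_pt).mpr hsand
  have h2S : 2 ≤ coheight (⟨f.base x', hyS⟩ : ↥S) := by
    have h2 := (two_le_coheight_iff_exists_sandwich hirrS hclS hS.2 hsc).mpr hsandS
    have e : (⟨s.pt, hS.2⟩ : ↥S) = ⟨f.base x', hyS⟩ := Subtype.ext hfx.symm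
    rwa [e] at h2
  -- `dim 𝒪_{X_n,y} ≤ 3`
  have hyX : coheight (f.base x') ≤ (3 : ℕ) := (topologicalKrullDim_le_iff_forall_coheight_le s.W 3).mp h.dim_le (f.base x')
  have hdimX : ringKrullDim (s.W.presheaf.stalk (f.base x')) ≤ ((3 : ℕ) : WithBot ℕ∞) := by
    rw [AlgebraicGeometry.ringKrullDim_stalk_eq_coheight]
    have h1 : ((coheight (f.base x') : ℕ∞) : WithBot ℕ∞) ≤ (((3 : ℕ) : ℕ∞) : WithBot ℕ∞) := WithBot.coe_le_coe.mpr hyX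
    rwa [WithBot.coe_natCast] at h1
  -- `dim 𝒪_{V(C),y} = s ≥ 2`
  have hperm : IdealSheafData.IsPermissibleAt C (f.base x') := hpermC (f.base x') hyC
  haveI hregC : IsRegularLocalRing (s.W.presheaf.stalk (f.base x') ⧸ stalkIdeal C (f.base x')) := hperm.1
  obtain ⟨d, hd⟩ : ∃ d : ℕ, ringKrullDim (s.W.presheaf.stalk (f.base x') ⧸ stalkIdeal C (f.base x')) = d :=
    exists_nat_eq_of_ne_bot_of_ne_top ringKrullDim_ne_bot ringKrullDim_ne_top
  have h2d : 2 ≤ d := by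
    have h1 : ((coheight (⟨f.base x', hyC⟩ : ↥(C.support : Set s.W)) : ℕ∞) : WithBot ℕ∞) ≤ (((d : ℕ) : ℕ∞) : WithBot ℕ∞) := by
      have h1 := coheight_le_ringKrullDim_quotient_stalkIdeal C hyC
      rw [hd] at h1
      rwa [← WithBot.coe_natCast] at h1
    have h1' : (coheight (⟨f.base x', hyC⟩ : ↥(C.support : Set s.W)) : ℕ∞) ≤ (d : ℕ∞) := WithBot.coe_le_coe.mp h1
    have h2 : coheight (⟨f.base x', hyS⟩ : ↥S) ≤ coheight (⟨f.base x', hyC⟩ : ↥(C.support : Set s.W)) :=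
      coheight_le_coheight_apply_of_strictMono (fun z : ↥S => (⟨z.1, hSsub z.2⟩ : ↥(C.support : Set s.W)))
        (fun _ _ hlt => hlt) ⟨f.base x', hyS⟩
    have h3 : ((2 : ℕ) : ℕ∞) ≤ (d : ℕ∞) := by
      have h4 : (2 : ℕ∞) ≤ (d : ℕ∞) := h2S.trans (h2.trans h1')
      exact_mod_cast h4
    exact_mod_cast h3
  -- the fibre over `y` is zero-dimensional at `x'`
  have hfib : ringKrullDim (s'.W.presheaf.stalk x' ⧸ (maximalIdeal (s.W.presheaf.stalk (f.base x'))).map (f.stalkMap x').hom) ≤ 0 := by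
    have key := hbl.ringKrullDim_stalk_quotient_map_maximalIdeal_add_le x' hperm hd
    set F := ringKrullDim (s'.W.presheaf.stalk x' ⧸ (maximalIdeal (s.W.presheaf.stalk (f.base x'))).map (f.stalkMap x').hom)
      with hF
    have h1 : F + ((d + 1 : ℕ) : WithBot ℕ∞) ≤ 0 + ((d + 1 : ℕ) : WithBot ℕ∞) := by
      refine (key.trans hdimX).trans ?_
      rw [zero_add]; exact_mod_cast (by omega : 3 ≤ d + 1)
    haveI : Nontrivial (s'.W.presheaf.stalk x' ⧸ (maximalIdeal (s.W.presheaf.stalk (f.base x'))).map (f.stalkMap x').hom) := by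
      refine Ideal.Quotient.nontrivial_iff.mpr (ne_top_of_le_ne_top (Ideal.IsPrime.ne_top
        (inferInstance : (maximalIdeal (s'.W.presheaf.stalk x')).IsPrime)) ?_)
      rw [Ideal.map_le_iff_le_comap]
      exact fun r hr => map_nonunit (f.stalkMap x').hom r hr
    obtain ⟨e, he⟩ : ∃ e : ℕ∞, F = e := by
      obtain ⟨e, he⟩ := WithBot.ne_bot_iff_exists.mp
        (ne_bot_of_le_ne_bot WithBot.coe_ne_bot (ringKrullDim_nonneg_of_nontrivial (R := s'.W.presheaf.stalk x' ⧸
          (maximalIdeal (s.W.presheaf.stalk (f.base x'))).map (f.stalkMap x').hom)))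
      exact ⟨e, he.symm⟩
    rw [he] at h1 ⊢
    have h2 : e + ((d + 1 : ℕ) : ℕ∞) ≤ 0 + ((d + 1 : ℕ) : ℕ∞) := by exact_mod_cast h1
    exact_mod_cast (ENat.add_le_add_iff_right (ENat.coe_ne_top _)).mp h2
  -- Matsumura 15.1: `codim_{Z'}(x') ≤ codim_B(y)`
  have hM := coheight_le_coheight_closure_image_add_ringKrullDim_fibre f hirrZ' hclZ' hx'Z'
  have hZ'B : coheight (⟨x', hx'Z'⟩ : ↥Z') ≤ coheight (⟨f.base x', hyB⟩ : ↥(closure (f.base '' Z'))) := by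
    have h1 : ((coheight (⟨x', hx'Z'⟩ : ↥Z') : ℕ∞) : WithBot ℕ∞) ≤
        ((coheight (⟨f.base x', hyB⟩ : ↥(closure (f.base '' Z'))) : ℕ∞) : WithBot ℕ∞) + 0 :=
      hM.trans (add_le_add le_rfl hfib)
    rw [add_zero] at h1
    exact_mod_cast h1
  -- `codim_B(y) ≤ 1`
  have hgenS : IsGenericPoint hirrS.genericPoint S := hirrS.isGenericPoint_genericPoint hclS
  set ηS := hirrS.genericPoint with hηS
  have hηSν : Scheme.hsFun s.W 3 ηS = ν := Scheme.mem_hsStratum_iff.mp (componentsIn.subset hS.1 hgenS.mem)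
  have hηS_notmax : ¬ IsMax ηS := by
    intro hmax
    have hco : coheight ηS = 0 := coheight_eq_zero.mpr hmax
    have hdim0 : ringKrullDim (s.W.presheaf.stalk ηS) = 0 := by
      rw [AlgebraicGeometry.ringKrullDim_stalk_eq_coheight, hco]; rfl
    have hmin : maximalIdeal (s.W.presheaf.stalk ηS) ∈ minimalPrimes (s.W.presheaf.stalk ηS) := by
      rw [← Ideal.height_eq_zero_iff]
      have h1 := IsLocalRing.maximalIdeal_height_eq_ringKrullDim (R := s.W.presheaf.stalk ηS)
      rw [hdim0] at h1
      exact_mod_cast h1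
    exact hν (hηSν.symm.trans (Helpers.hsFun_eq_iterPSum_Phi_of_maximalIdeal_mem_minimalPrimes (Y := s.W) 3 hmin))
  obtain ⟨ξ, hξ⟩ := not_isMax_iff.mp hηS_notmax
  have hB1 : coheight (⟨f.base x', hyB⟩ : ↥(closure (f.base '' Z'))) ≤ 1 := by
    refine coheight_le_iff'.mpr fun q hq => ?_
    have hlast : (q.last : s.W) < ηS := by
      have hmemS : (q.last : s.W) ∈ S := hBS q.last.2
      refine lt_iff_le_not_ge.mpr ⟨Scheme.le_iff_specializes.mpr (hgenS.specializes hmemS), fun hle => hBneS ?_⟩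
      have hηB : ηS ∈ closure (f.base '' Z') := by
        have h1 : ηS ∈ closure ({(q.last : s.W)} : Set s.W) :=
          specializes_iff_mem_closure.mp (Scheme.le_iff_specializes.mp hle)
        exact closure_minimal (Set.singleton_subset_iff.mpr q.last.2) isClosed_closure h1
      refine le_antisymm hBS ?_
      rw [← hgenS.def]
      exact closure_minimal (Set.singleton_subset_iff.mpr hηB) isClosed_closure
    let r : LTSeries s.W := ((q.map Subtype.val fun _ _ hlt => hlt).snoc ηS (by
      rw [LTSeries.last_map]; exact hlast)).snoc ξ (by rw [RelSeries.last_snoc]; exact hξ)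
    have hrhead : r.head = f.base x' := by
      simp only [r, RelSeries.head_snoc, LTSeries.head_map, hq]
    have hrlen : r.length = q.length + 2 := by
      simp only [r, RelSeries.snoc_length, LTSeries.map_length]
    have h1 := length_le_coheight_head (p := r)
    rw [hrhead, hrlen] at h1
    have h2 : q.length + 2 ≤ 3 := by exact_mod_cast h1.trans hyX
    exact_mod_cast (by omega : q.length ≤ 1)
  have : (2 : ℕ∞) ≤ 1 := h2Z'.trans (hZ'B.trans hB1)
  exact absurd this (by decide)

end Summit.ResolutionOfSingularities.ResolutionOfSingularities.Theorems.SigmaMaxModificationsCorridor3.Moving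

end
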